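import Summits.Ventures.PackingBounds.Energy.GramListQuad
import HarnessLib

/-!
# Kernel-checkable congruence `X = B Y Bᵀ` on integer data (basis change of a Gram block)

Framing: lottery ticket; floor = certified bounds/negative ranges. Venture `PackingBounds`, cell
`pub-packcert`, energy family E3PT (pub-packcert-energy gen 13; the `n = 4` kernel route).

Second half of the KERNEL-D6 data route. A sum-of-squares certificate gives its Gram block `Y` (`r × r`,
positive definite, checked PSD on integer data by `GramData.psd_of_checks`) on a FACE basis `w = Bᵀ m` of the
monomial vector `m` (`A` monomials). The slack polynomial is `mᵀ X m` with `X = B Y Bᵀ` (`A × A`); instead of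
expanding `Σ_{ij} Y_{ij} w_i w_j` by `ring` (too large for the kernel when the face basis is not very sparse), the
integer identity `X_{ab} = Σ_i Σ_j B_{ai} Y_{ij} B_{bj}` is checked by `decide +kernel` (`checkCongr`, zero entries
of `B` skipped, one theorem per chunk of rows), and `congr_quadForm` transports
`Σ_{a,b} X_{ab} z_a z_b = Σ_{i,j} Y_{ij} (Σ_a B_{ai} z_a)(Σ_b B_{bj} z_b)` to `ℝ` for every real vector `z`; with
`psd_of_checks` this gives `Σ_{a,b} X_{ab} z_a z_b ≥ 0` (`congr_quadForm_nonneg`), and `GramData.listQuad_eq_sum_ent`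
links the left side to the structurally unfolding `listQuad z X 0` used by the certificate files. No polynomial
identity of quadratic size is expanded by a tactic.
-/

namespace Summit.Ventures.PackingBounds.Energy.GramData

open Finset

/-- `Σ_k [q_k ≠ 0] q_k · Y_{i, j0+k}` along a row `q` of `B` (zero entries skipped). -/
def cgInner (Y : List (List ℤ)) (i : ℕ) : List ℤ → ℕ → ℤ
  | [], _ => 0
  | q :: qs, j => (if q = 0 then 0 else q * ent Y i j) + cgInner Y i qs (j + 1)

/-- `Σ_k [p_k ≠ 0] p_k · (cgInner Y (i0+k) rowb 0)` along a row `p` of `B` (zero entries skipped). -/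
def cgOuter (Y : List (List ℤ)) (rowb : List ℤ) : List ℤ → ℕ → ℤ
  | [], _ => 0
  | p :: ps, i => (if p = 0 then 0 else p * cgInner Y i rowb 0) + cgOuter Y rowb ps (i + 1)

/-- Rows `a0 ≤ a < a1`, columns `b < A`: `X_{ab} = Σ_i B_{ai} Σ_j B_{bj} Y_{ij}`. -/
def checkCongr (A a0 a1 : ℕ) (B Y X : List (List ℤ)) : Bool :=
  ((List.range a1).filter (fun a => a0 ≤ a)).all fun a => (List.range A).all fun b =>
    ent X a b == cgOuter Y (B.getD b []) (B.getD a []) 0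

/-- `cgInner` is the finite sum it computes (cast to `ℝ`). -/
theorem cgInner_eq (Y : List (List ℤ)) (i : ℕ) :
    ∀ (row : List ℤ) (j0 : ℕ),
      (cgInner Y i row j0 : ℝ) = ∑ k ∈ range row.length, (row.getD k 0 : ℝ) * (ent Y i (j0 + k) : ℝ)
  | [], j0 => by simp [cgInner]
  | q :: qs, j0 => by
    rw [cgInner, List.length_cons, Finset.sum_range_succ', Int.cast_add, cgInner_eq Y i qs (j0 + 1)]
    simp only [List.getD_cons_zero, List.getD_cons_succ, Nat.add_zero]
    have hq : (((if q = 0 then 0 else q * ent Y i j0 : ℤ)) : ℝ) = (q : ℝ) * (ent Y i j0 : ℝ) := by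
      split_ifs with h
      · simp [h]
      · push_cast; ring
    rw [hq, add_comm]
    congr 1
    refine Finset.sum_congr rfl fun k _ => ?_
    rw [show j0 + 1 + k = j0 + (k + 1) by omega]

/-- `cgOuter` is the finite sum it computes (cast to `ℝ`). -/
theorem cgOuter_eq (Y : List (List ℤ)) (rowb : List ℤ) :
    ∀ (row : List ℤ) (i0 : ℕ),
      (cgOuter Y rowb row i0 : ℝ) = ∑ k ∈ range row.length, (row.getD k 0 : ℝ) * (cgInner Y (i0 + k) rowb 0 : ℝ)
  | [], i0 => by simp [cgOuter]
  | p :: ps, i0 => by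
    rw [cgOuter, List.length_cons, Finset.sum_range_succ', Int.cast_add, cgOuter_eq Y rowb ps (i0 + 1)]
    simp only [List.getD_cons_zero, List.getD_cons_succ, Nat.add_zero]
    have hp : (((if p = 0 then 0 else p * cgInner Y i0 rowb 0 : ℤ)) : ℝ) = (p : ℝ) * (cgInner Y i0 rowb 0 : ℝ) := by
      split_ifs with h
      · simp [h]
      · push_cast; ring
    rw [hp, add_comm]
    congr 1
    refine Finset.sum_congr rfl fun k _ => ?_
    rw [show i0 + 1 + k = i0 + (k + 1) by omega]

/-- Unpack a checked chunk of rows of the congruence. -/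
theorem of_checkCongr {A a0 a1 : ℕ} {B Y X : List (List ℤ)} (h : checkCongr A a0 a1 B Y X = true) :
    ∀ a b, a0 ≤ a → a < a1 → b < A → ent X a b = cgOuter Y (B.getD b []) (B.getD a []) 0 := by
  intro a b ha0 ha1 hb
  simp only [checkCongr, List.all_eq_true, List.mem_filter, List.mem_range, decide_eq_true_eq,
    beq_iff_eq] at h
  exact h a ⟨ha1, ha0⟩ b hb

/-- The checked entry as a dense double sum over `ℝ`. -/
theorem ent_eq_sum_of_congr (A r : ℕ) (B Y X : List (List ℤ))
    (hB : ∀ a, a < A → (B.getD a []).length = r)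
    (hX : ∀ a b, a < A → b < A → ent X a b = cgOuter Y (B.getD b []) (B.getD a []) 0)
    (a b : Fin A) :
    (ent X a b : ℝ) = ∑ i : Fin r, ∑ j : Fin r, (ent B a i : ℝ) * (ent Y i j : ℝ) * (ent B b j : ℝ) := by
  rw [hX a b a.2 b.2, cgOuter_eq, hB a a.2,
    Fin.sum_univ_eq_sum_range (fun i => ∑ j : Fin r, (ent B a i : ℝ) * (ent Y i j : ℝ) * (ent B b j : ℝ)) r]
  refine Finset.sum_congr rfl fun i _ => ?_
  rw [Nat.zero_add, cgInner_eq, hB b b.2,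
    Fin.sum_univ_eq_sum_range (fun j => (ent B a i : ℝ) * (ent Y i j : ℝ) * (ent B b j : ℝ)) r, Finset.mul_sum]
  refine Finset.sum_congr rfl fun j _ => ?_
  simp only [Nat.zero_add, ent]
  ring

/-- **Congruence transported to quadratic forms.** If every row of `B` (`a < A`) has length `r` and
`X_{ab} = Σ_i Σ_j B_{ai} Y_{ij} B_{bj}` for `a, b < A` (from `of_checkCongr`), then for every real vector `z`,
`Σ_{a,b<A} X_{ab} z_a z_b = Σ_{i,j<r} Y_{ij} (Σ_a B_{ai} z_a) (Σ_b B_{bj} z_b)`. -/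
theorem congr_quadForm (A r : ℕ) (B Y X : List (List ℤ))
    (hB : ∀ a, a < A → (B.getD a []).length = r)
    (hX : ∀ a b, a < A → b < A → ent X a b = cgOuter Y (B.getD b []) (B.getD a []) 0) (z : ℕ → ℝ) :
    ∑ a : Fin A, ∑ b : Fin A, (ent X a b : ℝ) * z a * z b
      = ∑ i : Fin r, ∑ j : Fin r, (ent Y i j : ℝ) * (∑ a : Fin A, (ent B a i : ℝ) * z a)
          * (∑ b : Fin A, (ent B b j : ℝ) * z b) := by
  have hXr := ent_eq_sum_of_congr A r B Y X hB hX
  -- both sides equal the quadruple sum Σ_a Σ_b Σ_i Σ_j B_ai Y_ij B_bj z_a z_b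
  have hL : ∑ a : Fin A, ∑ b : Fin A, (ent X a b : ℝ) * z a * z b
      = ∑ a : Fin A, ∑ b : Fin A, ∑ i : Fin r, ∑ j : Fin r,
          (ent B a i : ℝ) * (ent Y i j : ℝ) * (ent B b j : ℝ) * z a * z b := by
    refine Finset.sum_congr rfl fun a _ => Finset.sum_congr rfl fun b _ => ?_
    rw [hXr a b, Finset.sum_mul, Finset.sum_mul]
    refine Finset.sum_congr rfl fun i _ => ?_
    rw [Finset.sum_mul, Finset.sum_mul]
  have hR : ∑ i : Fin r, ∑ j : Fin r, (ent Y i j : ℝ) * (∑ a : Fin A, (ent B a i : ℝ) * z a)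
          * (∑ b : Fin A, (ent B b j : ℝ) * z b)
      = ∑ i : Fin r, ∑ j : Fin r, ∑ a : Fin A, ∑ b : Fin A,
          (ent B a i : ℝ) * (ent Y i j : ℝ) * (ent B b j : ℝ) * z a * z b := by
    refine Finset.sum_congr rfl fun i _ => Finset.sum_congr rfl fun j _ => ?_
    rw [mul_assoc, Finset.sum_mul_sum, Finset.mul_sum]
    refine Finset.sum_congr rfl fun a _ => ?_
    rw [Finset.mul_sum]
    refine Finset.sum_congr rfl fun b _ => ?_
    ring
  rw [hL, hR]
  -- reorder Σ_i Σ_j Σ_a Σ_b → Σ_a Σ_b Σ_i Σ_j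
  symm
  calc ∑ i : Fin r, ∑ j : Fin r, ∑ a : Fin A, ∑ b : Fin A,
          (ent B a i : ℝ) * (ent Y i j : ℝ) * (ent B b j : ℝ) * z a * z b
      = ∑ i : Fin r, ∑ a : Fin A, ∑ j : Fin r, ∑ b : Fin A,
          (ent B a i : ℝ) * (ent Y i j : ℝ) * (ent B b j : ℝ) * z a * z b := by
        refine Finset.sum_congr rfl fun i _ => ?_
        rw [Finset.sum_comm]
    _ = ∑ a : Fin A, ∑ i : Fin r, ∑ j : Fin r, ∑ b : Fin A,
          (ent B a i : ℝ) * (ent Y i j : ℝ) * (ent B b j : ℝ) * z a * z b := by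
        rw [Finset.sum_comm]
    _ = ∑ a : Fin A, ∑ i : Fin r, ∑ b : Fin A, ∑ j : Fin r,
          (ent B a i : ℝ) * (ent Y i j : ℝ) * (ent B b j : ℝ) * z a * z b := by
        refine Finset.sum_congr rfl fun a _ => Finset.sum_congr rfl fun i _ => ?_
        rw [Finset.sum_comm]
    _ = ∑ a : Fin A, ∑ b : Fin A, ∑ i : Fin r, ∑ j : Fin r,
          (ent B a i : ℝ) * (ent Y i j : ℝ) * (ent B b j : ℝ) * z a * z b := by
        refine Finset.sum_congr rfl fun a _ => ?_
        rw [Finset.sum_comm]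

/-- **Nonnegativity on the monomial side.** Under the hypotheses of `congr_quadForm` and the integer PSD facts for
`Y` (`GramData.psd_of_checks`: `Y = L Lᵀ + E` rows and diagonal dominance of `E`), `Σ_{a,b<A} X_{ab} z_a z_b ≥ 0`
for every real vector `z`. -/
theorem congr_quadForm_nonneg (A r s : ℕ) (B Y X L E : List (List ℤ))
    (hB : ∀ a, a < A → (B.getD a []).length = r)
    (hX : ∀ a b, a < A → b < A → ent X a b = cgOuter Y (B.getD b []) (B.getD a []) 0)
    (hrows : ∀ i j, i < r → j < r → ent Y i j = dotRows L i j s + ent E i j ∧ ent E i j = ent E j i)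
    (hdd : ∀ i, i < r → absRow E i r ≤ 2 * ent E i i) (z : ℕ → ℝ) :
    0 ≤ ∑ a : Fin A, ∑ b : Fin A, (ent X a b : ℝ) * z a * z b := by
  rw [congr_quadForm A r B Y X hB hX z]
  exact psd_of_checks r s Y L E hrows hdd (fun i : Fin r => ∑ a : Fin A, (ent B a i : ℝ) * z a)

/-- The same for the structurally unfolding `listQuad z X 0` of an `A × A` table `X`. -/
theorem listQuad_nonneg_of_congr (A r s : ℕ) (B Y X L E : List (List ℤ))
    (hXlen : X.length = A) (hXrow : ∀ m, m < A → (X.getD m []).length = A)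
    (hB : ∀ a, a < A → (B.getD a []).length = r)
    (hX : ∀ a b, a < A → b < A → ent X a b = cgOuter Y (B.getD b []) (B.getD a []) 0)
    (hrows : ∀ i j, i < r → j < r → ent Y i j = dotRows L i j s + ent E i j ∧ ent E i j = ent E j i)
    (hdd : ∀ i, i < r → absRow E i r ≤ 2 * ent E i i) (z : ℕ → ℝ) :
    0 ≤ listQuad z X 0 := by
  rw [listQuad_eq_sum_ent z X A hXlen hXrow]
  exact congr_quadForm_nonneg A r s B Y X L E hB hX hrows hdd z

end Summit.Ventures.PackingBounds.Energy.GramData
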